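import Mathlib
import Literature.NumberTheory.Transcendental.KZSliceFubini
import Literature.NumberTheory.DiophantineApproximation.ViolaZudilinPhiTransformation
import Summits.KontsevichZagierPeriods.Zeta5Search.EulerKernelSymmetry
import Summits.KontsevichZagierPeriods.Zeta5Search.JintegralEulerSymmetry
import HarnessLib

/-!
# ζ(5) search — Rhin–Viola's generators `σ`, `φ`, `χ` on the Beukers-type triple integrals (cell `pub-zeta5`, seat ct-1 g12)

HONEST FRAMING: systematic search; no irrationality claim unless kernel-certified. Nothing in this file is an
irrationality result, a worthiness exponent or a denominator statement. For integers `h, l, k, s, j, q, c` put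

  `T(h,l,k,s,j,q,c) = ∫_{(0,1)³} x^h (1−x)^l y^k (1−y)^s z^j (1−z)^q (1−(1−xy)z)^{−c} dx dy dz`

(Bochner; Rhin–Viola's `I(h,j,k,l,m,q,r,s)` is `T(h,l,k,s,j,q,q+h−r+1)` [G. Rhin, C. Viola, *The group
structure for ζ(3)*, Acta Arith. 97 (2001), (2.1)]; Brown–Zudilin's generalised Beukers integral (23) is
`J₃(p₀,p₁,p₂,p₃;q₁,q₂,q₃) = T(p₁,q₁,p₂,q₂,p₃,q₃,p₀+1)` [BrownZudilin2022, (23)]). Rhin–Viola's permutation group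
`Φ = ⟨ϑ, σ, φ, χ⟩` (order 1920) is generated by the birational map `ϑ` (`RhinViolaTheta.lean`) and three
ELEMENTARY moves, proved here for all admissible integer exponents and with no convergence hypothesis
(both sides are junk `0` together):

* `rv_sigma` — `σ`: `T(h,l,k,s,j,q,c) = T(k,s,h,l,j,q,c)` (swap `x ↔ y`) [RV §2];
* `rv_phi` — `φ`, "the hypergeometric integral transformation … in the variable `x`" [RV (4.1)]:
  `m!(h+l−m)!·T(h,l,k,s,j,q,m+1) = h!l!·T(m, h+l−m, k, s, j, q+h−m, h+1)` (`h,l,m ∈ ℕ`, `m ≤ h+l`; RV's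
  `I(h,…)/(h!l!) = I(q+h−r, j, k, r+l−q, m, r, q, s)/((q+h−r)!(r+l−q)!)` with `m = q+h−r`), from
  `EulerKernelSymmetry.euler_symmetry` in `x` (kernel `(1−z) + yz·x`) and Tonelli over `(y,z)`;
* `rv_chi` — `χ`, the same transformation in `z` [RV §4, display before (4.2)]:
  `m!(j+q−m)!·T(h,l,k,s,j,q,m+1) = j!q!·T(h,l,k,s,m,j+q−m,j+1)` (`j,q,m ∈ ℕ`, `m ≤ j+q`), from the tree's
  `RhinViola.euler_integral_symm_nat` in `z` (kernel `1 − (1−xy)·z`) after a cyclic permutation of coordinates.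

Infrastructure (theorems only): Tonelli along the first coordinate of `(0,1)³` in a junk-safe form
(`setIntegral_cube3_eq_of_slices`, pattern of `JintegralEulerSymmetry.lean`) and coordinate permutations of the cube
(`setIntegral_cube3_perm`). These four generators are the announced ingredients of a Bailey-free route to
Brown–Zudilin's `h, h'` (memo `ct-1/g12/EULERSYM.md` §3; with complex exponents the hypergeometric moves are the tree's
`Hypergeometric.eulerHypergeometric_symm`).
-/

noncomputable section

namespace Summit.KontsevichZagierPeriods.Zeta5Search.RhinViolaGenerators

open MeasureTheory Set Filter
open scoped ENNReal Nat
open Literature.NumberTheory.Transcendental (KZ.measurePreserving_vecCons KZ.measurableEmbedding_vecCons)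
open Literature.NumberTheory.DiophantineApproximation (RhinViola.euler_integral_symm_nat)
open Summit.KontsevichZagierPeriods.Zeta5Search.EulerKernelSymmetry (euler_symmetry)
open Summit.KontsevichZagierPeriods.Zeta5Search.JintegralEulerSymmetry (zpow_natCast_add_one
  setIntegral_Ioo_eq_intervalIntegral)

/-! ### The cube `(0,1)³`: slices and coordinate permutations -/

/-- Membership in `(0,1)ⁿ` unpacked. -/
theorem mem_cube {n : ℕ} {x : Fin n → ℝ} (hx : x ∈ (univ.pi fun _ : Fin n => Ioo (0:ℝ) 1)) (i : Fin n) :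
    0 < x i ∧ x i < 1 := by
  simpa using hx i (mem_univ i)

/-- The cube is measurable. -/
theorem measurableSet_cube (n : ℕ) : MeasurableSet (univ.pi fun _ : Fin n => Ioo (0:ℝ) 1) :=
  MeasurableSet.univ_pi fun _ => measurableSet_Ioo

/-- `vecCons s x ∈ (0,1)³` iff `s ∈ (0,1)` and `x ∈ (0,1)²`. -/
theorem vecCons_mem_cube3_iff (s : ℝ) (x : Fin 2 → ℝ) :
    Matrix.vecCons s x ∈ (univ.pi fun _ : Fin 3 => Ioo (0:ℝ) 1) ↔
      s ∈ Ioo (0:ℝ) 1 ∧ x ∈ (univ.pi fun _ : Fin 2 => Ioo (0:ℝ) 1) := by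
  simp only [mem_univ_pi, Fin.forall_fin_succ, Matrix.cons_val_zero, Matrix.cons_val_succ, mem_Ioo]

/-- The preimage of `(0,1)³` under `(s, x) ↦ vecCons s x` is `(0,1) × (0,1)²`. -/
theorem vecCons_preimage_cube3 :
    (fun p : ℝ × (Fin 2 → ℝ) => Matrix.vecCons p.1 p.2) ⁻¹' (univ.pi fun _ : Fin 3 => Ioo (0:ℝ) 1) =
      Ioo (0:ℝ) 1 ×ˢ (univ.pi fun _ : Fin 2 => Ioo (0:ℝ) 1) := by
  ext ⟨s, x⟩
  rw [mem_preimage, mem_prod]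
  exact vecCons_mem_cube3_iff s x

/-- Tonelli along the first coordinate of `(0,1)³`. -/
theorem lintegral_cube3_slice (F : (Fin 3 → ℝ) → ℝ≥0∞) (hF : Measurable F) :
    ∫⁻ y in (univ.pi fun _ : Fin 3 => Ioo (0:ℝ) 1), F y =
      ∫⁻ x in (univ.pi fun _ : Fin 2 => Ioo (0:ℝ) 1), ∫⁻ s in Ioo (0:ℝ) 1, F (Matrix.vecCons s x) := by
  rw [← (KZ.measurePreserving_vecCons (n := 2)).setLIntegral_comp_preimage_emb KZ.measurableEmbedding_vecCons F
      (univ.pi fun _ : Fin 3 => Ioo (0:ℝ) 1), vecCons_preimage_cube3, ← Measure.prod_restrict, lintegral_prod_symm]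
  exact (hF.comp (KZ.measurableEmbedding_vecCons (n := 2)).measurable).aemeasurable

/-- The cube integral of a measurable function, non-negative on the cube, with integrable slices is the extended
integral of its slice integrals (no integrability on the cube needed). -/
theorem setIntegral_cube3_eq_lintegral_slices {H : (Fin 3 → ℝ) → ℝ} (hHm : Measurable H)
    (hH0 : ∀ y ∈ (univ.pi fun _ : Fin 3 => Ioo (0:ℝ) 1), 0 ≤ H y)
    (hHi : ∀ x ∈ (univ.pi fun _ : Fin 2 => Ioo (0:ℝ) 1), IntegrableOn (fun s => H (Matrix.vecCons s x)) (Ioo 0 1)) :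
    ∫ y in (univ.pi fun _ : Fin 3 => Ioo (0:ℝ) 1), H y =
      (∫⁻ x in (univ.pi fun _ : Fin 2 => Ioo (0:ℝ) 1),
        ENNReal.ofReal (∫ s in Ioo (0:ℝ) 1, H (Matrix.vecCons s x))).toReal := by
  rw [integral_eq_lintegral_of_nonneg_ae (ae_restrict_of_forall_mem (measurableSet_cube 3) hH0)
      hHm.aestronglyMeasurable,
    lintegral_cube3_slice (fun y => ENNReal.ofReal (H y)) (ENNReal.measurable_ofReal.comp hHm)]
  congr 1
  refine setLIntegral_congr_fun (measurableSet_cube 2) (fun x hx => ?_)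
  rw [ofReal_integral_eq_lintegral_ofReal (hHi x hx)]
  exact ae_restrict_of_forall_mem measurableSet_Ioo fun s hs =>
    hH0 _ ((vecCons_mem_cube3_iff s x).mpr ⟨hs, hx⟩)

/-- **Slice lemma on `(0,1)³`**: proportional first-coordinate slice integrals give proportional cube integrals
(measurable functions, non-negative on the cube, integrable slices; no integrability on the cube). -/
theorem setIntegral_cube3_eq_of_slices {F G : (Fin 3 → ℝ) → ℝ} (hFm : Measurable F) (hGm : Measurable G)
    (hF0 : ∀ y ∈ (univ.pi fun _ : Fin 3 => Ioo (0:ℝ) 1), 0 ≤ F y)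
    (hG0 : ∀ y ∈ (univ.pi fun _ : Fin 3 => Ioo (0:ℝ) 1), 0 ≤ G y) {c d : ℝ} (hc : 0 ≤ c) (hd : 0 ≤ d)
    (h : ∀ x ∈ (univ.pi fun _ : Fin 2 => Ioo (0:ℝ) 1),
      IntegrableOn (fun s => F (Matrix.vecCons s x)) (Ioo 0 1) ∧
        IntegrableOn (fun s => G (Matrix.vecCons s x)) (Ioo 0 1) ∧
        c * ∫ s in Ioo (0:ℝ) 1, F (Matrix.vecCons s x) = d * ∫ s in Ioo (0:ℝ) 1, G (Matrix.vecCons s x)) :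
    c * ∫ y in (univ.pi fun _ : Fin 3 => Ioo (0:ℝ) 1), F y = d * ∫ y in (univ.pi fun _ : Fin 3 => Ioo (0:ℝ) 1), G y := by
  rw [setIntegral_cube3_eq_lintegral_slices hFm hF0 (fun x hx => (h x hx).1),
    setIntegral_cube3_eq_lintegral_slices hGm hG0 (fun x hx => (h x hx).2.1),
    ← ENNReal.toReal_ofReal hc, ← ENNReal.toReal_ofReal hd, ← ENNReal.toReal_mul, ← ENNReal.toReal_mul,
    ← lintegral_const_mul' _ _ ENNReal.ofReal_ne_top, ← lintegral_const_mul' _ _ ENNReal.ofReal_ne_top]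
  congr 1
  refine setLIntegral_congr_fun (measurableSet_cube 2) (fun x hx => ?_)
  rw [← ENNReal.ofReal_mul hc, ← ENNReal.ofReal_mul hd, (h x hx).2.2]

/-- **Coordinate permutations of the cube**: `∫_{(0,1)³} g(x ∘ σ) = ∫_{(0,1)³} g` for every permutation `σ`. -/
theorem setIntegral_cube3_perm (σ : Equiv.Perm (Fin 3)) (g : (Fin 3 → ℝ) → ℝ) :
    ∫ x in (univ.pi fun _ : Fin 3 => Ioo (0:ℝ) 1), g (fun i => x (σ i)) =
      ∫ x in (univ.pi fun _ : Fin 3 => Ioo (0:ℝ) 1), g x := by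
  let e : (Fin 3 → ℝ) ≃ᵐ (Fin 3 → ℝ) := MeasurableEquiv.piCongrLeft (fun _ : Fin 3 => ℝ) σ.symm
  have he : ∀ x : Fin 3 → ℝ, (e x : Fin 3 → ℝ) = fun i => x (σ i) := by
    intro x; ext i
    simp [e, MeasurableEquiv.coe_piCongrLeft, Equiv.piCongrLeft_apply_eq_cast]
  have hmp : MeasurePreserving e volume volume := volume_measurePreserving_piCongrLeft (fun _ : Fin 3 => ℝ) σ.symm
  have hpre : e ⁻¹' (univ.pi fun _ : Fin 3 => Ioo (0:ℝ) 1) = (univ.pi fun _ : Fin 3 => Ioo (0:ℝ) 1) := by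
    ext x
    simp only [Set.mem_preimage, he, mem_univ_pi]
    exact ⟨fun h i => by simpa using h (σ.symm i), fun h i => h (σ i)⟩
  have key := hmp.setIntegral_preimage_emb e.measurableEmbedding g (univ.pi fun _ : Fin 3 => Ioo (0:ℝ) 1)
  rw [hpre] at key
  simpa only [he] using key

/-- Swap of the first two coordinates. -/
theorem setIntegral_cube3_swap (g : (Fin 3 → ℝ) → ℝ) :
    ∫ x in (univ.pi fun _ : Fin 3 => Ioo (0:ℝ) 1), g ![x 1, x 0, x 2] =
      ∫ x in (univ.pi fun _ : Fin 3 => Ioo (0:ℝ) 1), g x := by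
  rw [← setIntegral_cube3_perm (Equiv.swap 0 1) g]
  refine setIntegral_congr_fun (measurableSet_cube 3) fun x _ => ?_
  congr 1
  ext i; fin_cases i <;> simp [Equiv.swap_apply_def]

/-- Cyclic permutation bringing the last coordinate to the front. -/
theorem setIntegral_cube3_rotate (g : (Fin 3 → ℝ) → ℝ) :
    ∫ x in (univ.pi fun _ : Fin 3 => Ioo (0:ℝ) 1), g ![x 1, x 2, x 0] =
      ∫ x in (univ.pi fun _ : Fin 3 => Ioo (0:ℝ) 1), g x := by
  rw [← setIntegral_cube3_perm (Equiv.swap 0 1 * Equiv.swap 1 2) g]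
  refine setIntegral_congr_fun (measurableSet_cube 3) fun x _ => ?_
  congr 1
  ext i; fin_cases i <;> simp [Equiv.swap_apply_def, Equiv.Perm.mul_apply]

/-! ### The integrand -/

/-- The RV integrand is measurable. -/
theorem measurable_rvIntegrand (h l k s j q c : ℤ) :
    Measurable (fun x : Fin 3 → ℝ => x 0 ^ h * (1 - x 0) ^ l * x 1 ^ k * (1 - x 1) ^ s * x 2 ^ j * (1 - x 2) ^ q /
      (1 - (1 - x 0 * x 1) * x 2) ^ c) := by
  fun_prop

/-- Basic positivity on the cube: `0 < 1 − (1−xy)z`. -/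
theorem link_pos {x y z : ℝ} (hx : 0 < x ∧ x < 1) (hy : 0 < y ∧ y < 1) (hz : 0 < z ∧ z < 1) :
    0 < 1 - (1 - x * y) * z := by
  have hxy1 : x * y < 1 := by nlinarith [mul_lt_of_lt_one_right hx.1 hy.2]
  nlinarith [mul_lt_of_lt_one_right (sub_pos.mpr hxy1) hz.2]

/-- The RV integrand is non-negative on the cube. -/
theorem rvIntegrand_nonneg (h l k s j q c : ℤ) {x : Fin 3 → ℝ} (hx : x ∈ (univ.pi fun _ : Fin 3 => Ioo (0:ℝ) 1)) :
    0 ≤ x 0 ^ h * (1 - x 0) ^ l * x 1 ^ k * (1 - x 1) ^ s * x 2 ^ j * (1 - x 2) ^ q /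
      (1 - (1 - x 0 * x 1) * x 2) ^ c := by
  have h0 := mem_cube hx 0; have h1 := mem_cube hx 1; have h2 := mem_cube hx 2
  have a0 : 0 < 1 - x 0 := by linarith [h0.2]
  have a1 : 0 < 1 - x 1 := by linarith [h1.2]
  have a2 : 0 < 1 - x 2 := by linarith [h2.2]
  have hL := link_pos h0 h1 h2
  have c0 := h0.1; have c1 := h1.1; have c2 := h2.1
  positivity

/-- Integrability of the one-variable Euler kernel `s ↦ K·s^a(1−s)^b/(α+βs)^c` on `(0,1)` for `α > 0`, `α + β > 0`. -/
theorem integrableOn_kernel' (K : ℝ) {α β : ℝ} (hα : 0 < α) (hαβ : 0 < α + β) (a b c : ℕ) :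
    IntegrableOn (fun s : ℝ => K * (s ^ a * (1 - s) ^ b / (α + β * s) ^ c)) (Ioo 0 1) := by
  have hne : ∀ s ∈ Icc (0:ℝ) 1, (α + β * s) ^ c ≠ 0 := by
    intro s hs
    apply pow_ne_zero
    have : 0 < α + β * s := by
      rcases le_or_gt 0 β with hb | hb
      · nlinarith [mul_nonneg hb hs.1]
      · nlinarith [mul_le_mul_of_nonpos_left hs.2 hb.le]
    exact this.ne'
  have hc : ContinuousOn (fun s : ℝ => K * (s ^ a * (1 - s) ^ b / (α + β * s) ^ c)) (Icc 0 1) :=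
    ContinuousOn.mul continuousOn_const
      (ContinuousOn.div (Continuous.continuousOn (by fun_prop)) (Continuous.continuousOn (by fun_prop)) hne)
  exact (hc.integrableOn_Icc).mono_set Ioo_subset_Icc_self

/-! ### `σ`: the swap `x ↔ y` -/

/-- **Rhin–Viola's `σ`**: `T(h,l,k,s,j,q,c) = T(k,s,h,l,j,q,c)` — the integrand is symmetric under `x ↔ y` up to the
exponents [RV §2, "if we interchange the variables `x, y` in (2.1), we get `I(k,j,h,s,r,q,m,l)`"]. -/
theorem rv_sigma (h l k s j q c : ℤ) :
    ∫ x in (univ.pi fun _ : Fin 3 => Ioo (0:ℝ) 1),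
        x 0 ^ h * (1 - x 0) ^ l * x 1 ^ k * (1 - x 1) ^ s * x 2 ^ j * (1 - x 2) ^ q / (1 - (1 - x 0 * x 1) * x 2) ^ c =
      ∫ x in (univ.pi fun _ : Fin 3 => Ioo (0:ℝ) 1),
        x 0 ^ k * (1 - x 0) ^ s * x 1 ^ h * (1 - x 1) ^ l * x 2 ^ j * (1 - x 2) ^ q / (1 - (1 - x 0 * x 1) * x 2) ^ c := by
  rw [← setIntegral_cube3_swap]
  refine setIntegral_congr_fun (measurableSet_cube 3) fun x _ => ?_
  simp only [Matrix.cons_val_zero, Matrix.cons_val_one, Matrix.cons_val]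
  rw [mul_comm (x 1) (x 0)]
  ring

/-! ### `φ`: the hypergeometric transformation in `x` -/

/-- **Rhin–Viola's `φ`** [RV (4.1)]: for `h, l, m ∈ ℕ` with `m ≤ h + l` and arbitrary integers `k, s, j, q`,
`m!(h+l−m)! · T(h,l,k,s,j,q,m+1) = h!l! · T(m, h+l−m, k, s, j, q+h−m, h+1)`
(no convergence hypothesis; `EulerKernelSymmetry.euler_symmetry` in `x` with `α = 1−z`, `β = yz`, slice by slice). -/
theorem rv_phi (h l m : ℕ) (hm : m ≤ h + l) (k s j q : ℤ) :
    ((m ! * (h + l - m)! : ℕ) : ℝ) * ∫ x in (univ.pi fun _ : Fin 3 => Ioo (0:ℝ) 1),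
        x 0 ^ h * (1 - x 0) ^ l * x 1 ^ k * (1 - x 1) ^ s * x 2 ^ j * (1 - x 2) ^ q /
          (1 - (1 - x 0 * x 1) * x 2) ^ (m + 1) =
      ((h ! * l ! : ℕ) : ℝ) * ∫ x in (univ.pi fun _ : Fin 3 => Ioo (0:ℝ) 1),
        x 0 ^ m * (1 - x 0) ^ (h + l - m) * x 1 ^ k * (1 - x 1) ^ s * x 2 ^ j * (1 - x 2) ^ (q + h - m) /
          (1 - (1 - x 0 * x 1) * x 2) ^ (h + 1) := by
  have eF := measurable_rvIntegrand h l k s j q (m + 1)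
  have eG := measurable_rvIntegrand m (h + l - m : ℕ) k s j (q + h - m) (h + 1)
  simp only [zpow_natCast, zpow_natCast_add_one] at eF eG
  refine setIntegral_cube3_eq_of_slices eF eG (fun y hy => ?_) (fun y hy => ?_) (by positivity) (by positivity)
    (fun x hx => ?_)
  · have := rvIntegrand_nonneg h l k s j q (m + 1) hy
    simpa only [zpow_natCast, zpow_natCast_add_one] using this
  · have := rvIntegrand_nonneg m (h + l - m : ℕ) k s j (q + h - m) (h + 1) hy
    simpa only [zpow_natCast, zpow_natCast_add_one] using this
  have hy := mem_cube hx 0; have hz := mem_cube hx 1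
  have hα : 0 < 1 - x 1 := by linarith [hz.2]
  have hβ : 0 ≤ x 0 * x 1 := (mul_pos hy.1 hz.1).le
  -- the two slices as Euler kernels in `s = x₀`
  have hF : (fun t : ℝ => Matrix.vecCons t x 0 ^ h * (1 - Matrix.vecCons t x 0) ^ l * Matrix.vecCons t x 1 ^ k *
        (1 - Matrix.vecCons t x 1) ^ s * Matrix.vecCons t x 2 ^ j * (1 - Matrix.vecCons t x 2) ^ q /
        (1 - (1 - Matrix.vecCons t x 0 * Matrix.vecCons t x 1) * Matrix.vecCons t x 2) ^ (m + 1)) =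
      fun t => (x 0 ^ k * (1 - x 0) ^ s * x 1 ^ j * (1 - x 1) ^ q) *
        (t ^ h * (1 - t) ^ l / (1 - x 1 + x 0 * x 1 * t) ^ (m + 1)) := by
    funext t
    simp only [Matrix.cons_val_zero, Matrix.cons_val_one, Matrix.cons_val]
    rw [show (1:ℝ) - (1 - t * x 0) * x 1 = 1 - x 1 + x 0 * x 1 * t by ring]
    ring
  have hG : (fun t : ℝ => Matrix.vecCons t x 0 ^ m * (1 - Matrix.vecCons t x 0) ^ (h + l - m) *
        Matrix.vecCons t x 1 ^ k * (1 - Matrix.vecCons t x 1) ^ s * Matrix.vecCons t x 2 ^ j *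
        (1 - Matrix.vecCons t x 2) ^ (q + h - m) /
        (1 - (1 - Matrix.vecCons t x 0 * Matrix.vecCons t x 1) * Matrix.vecCons t x 2) ^ (h + 1)) =
      fun t => (x 0 ^ k * (1 - x 0) ^ s * x 1 ^ j * (1 - x 1) ^ q * (1 - x 1) ^ ((h : ℤ) - m)) *
        (t ^ m * (1 - t) ^ (h + l - m) / (1 - x 1 + x 0 * x 1 * t) ^ (h + 1)) := by
    funext t
    simp only [Matrix.cons_val_zero, Matrix.cons_val_one, Matrix.cons_val]
    rw [show (1:ℝ) - (1 - t * x 0) * x 1 = 1 - x 1 + x 0 * x 1 * t by ring,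
      show q + (h : ℤ) - (m : ℤ) = q + ((h : ℤ) - m) by ring, zpow_add₀ hα.ne']
    ring
  refine ⟨?_, ?_, ?_⟩
  · rw [hF]; exact integrableOn_kernel' _ hα (by linarith) _ _ _
  · rw [hG]; exact integrableOn_kernel' _ hα (by linarith) _ _ _
  · rw [hF, hG, integral_const_mul, integral_const_mul, setIntegral_Ioo_eq_intervalIntegral,
      setIntegral_Ioo_eq_intervalIntegral]
    have hE := euler_symmetry m h l hm hα hβ
    rw [zpow_sub₀ hα.ne', zpow_natCast, zpow_natCast]
    generalize (∫ t in (0:ℝ)..1, t ^ h * (1 - t) ^ l / (1 - x 1 + x 0 * x 1 * t) ^ (m + 1)) = I₁ at hE ⊢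
    generalize (∫ t in (0:ℝ)..1, t ^ m * (1 - t) ^ (h + l - m) / (1 - x 1 + x 0 * x 1 * t) ^ (h + 1)) = I₂ at hE ⊢
    set K : ℝ := x 0 ^ k * (1 - x 0) ^ s * x 1 ^ j * (1 - x 1) ^ q with hK
    have hαm : (1 - x 1) ^ m ≠ 0 := pow_ne_zero _ hα.ne'
    calc ((m ! * (h + l - m)! : ℕ) : ℝ) * (K * I₁)
        = K / (1 - x 1) ^ m * ((m ! : ℝ) * (h + l - m)! * (1 - x 1) ^ m * I₁) := by
          push_cast; field_simp
      _ = K / (1 - x 1) ^ m * ((h ! : ℝ) * l ! * (1 - x 1) ^ h * I₂) := by rw [hE]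
      _ = ((h ! * l ! : ℕ) : ℝ) * (K * ((1 - x 1) ^ h / (1 - x 1) ^ m) * I₂) := by
          push_cast; field_simp

/-! ### `χ`: the hypergeometric transformation in `z` -/

/-- **Rhin–Viola's `χ`** [RV §4]: for `j, q, m ∈ ℕ` with `m ≤ j + q` and arbitrary integers `h, l, k, s`,
`m!(j+q−m)! · T(h,l,k,s,j,q,m+1) = j!q! · T(h,l,k,s,m,j+q−m,j+1)`
(no convergence hypothesis; the tree's `RhinViola.euler_integral_symm_nat` in `z` with `t = 1 − xy`, slice by slice
after the cyclic permutation `(x,y,z) ↦ (z,x,y)` of the cube). -/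
theorem rv_chi (j q m : ℕ) (hm : m ≤ j + q) (h l k s : ℤ) :
    ((m ! * (j + q - m)! : ℕ) : ℝ) * ∫ x in (univ.pi fun _ : Fin 3 => Ioo (0:ℝ) 1),
        x 0 ^ h * (1 - x 0) ^ l * x 1 ^ k * (1 - x 1) ^ s * x 2 ^ j * (1 - x 2) ^ q /
          (1 - (1 - x 0 * x 1) * x 2) ^ (m + 1) =
      ((j ! * q ! : ℕ) : ℝ) * ∫ x in (univ.pi fun _ : Fin 3 => Ioo (0:ℝ) 1),
        x 0 ^ h * (1 - x 0) ^ l * x 1 ^ k * (1 - x 1) ^ s * x 2 ^ m * (1 - x 2) ^ (j + q - m) /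
          (1 - (1 - x 0 * x 1) * x 2) ^ (j + 1) := by
  -- move `z` to the front: `x ↦ (x₁, x₂, x₀)`
  rw [← setIntegral_cube3_rotate (fun x : Fin 3 → ℝ => x 0 ^ h * (1 - x 0) ^ l * x 1 ^ k * (1 - x 1) ^ s *
      x 2 ^ j * (1 - x 2) ^ q / (1 - (1 - x 0 * x 1) * x 2) ^ (m + 1)),
    ← setIntegral_cube3_rotate (fun x : Fin 3 → ℝ => x 0 ^ h * (1 - x 0) ^ l * x 1 ^ k * (1 - x 1) ^ s *
      x 2 ^ m * (1 - x 2) ^ (j + q - m) / (1 - (1 - x 0 * x 1) * x 2) ^ (j + 1))]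
  simp only [Matrix.cons_val_zero, Matrix.cons_val_one, Matrix.cons_val]
  have eF : Measurable (fun x : Fin 3 → ℝ => x 1 ^ h * (1 - x 1) ^ l * x 2 ^ k * (1 - x 2) ^ s * x 0 ^ j *
      (1 - x 0) ^ q / (1 - (1 - x 1 * x 2) * x 0) ^ (m + 1)) := by fun_prop
  have eG : Measurable (fun x : Fin 3 → ℝ => x 1 ^ h * (1 - x 1) ^ l * x 2 ^ k * (1 - x 2) ^ s * x 0 ^ m *
      (1 - x 0) ^ (j + q - m) / (1 - (1 - x 1 * x 2) * x 0) ^ (j + 1)) := by fun_prop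
  refine setIntegral_cube3_eq_of_slices eF eG (fun y hy => ?_) (fun y hy => ?_) (by positivity) (by positivity)
    (fun x hx => ?_)
  · have h0 := mem_cube hy 0; have h1 := mem_cube hy 1; have h2 := mem_cube hy 2
    have a0 : 0 < 1 - y 0 := by linarith [h0.2]
    have a1 : 0 < 1 - y 1 := by linarith [h1.2]
    have a2 : 0 < 1 - y 2 := by linarith [h2.2]
    have hL : 0 < 1 - (1 - y 1 * y 2) * y 0 := link_pos h1 h2 h0
    have c0 := h0.1; have c1 := h1.1; have c2 := h2.1
    positivity
  · have h0 := mem_cube hy 0; have h1 := mem_cube hy 1; have h2 := mem_cube hy 2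
    have a0 : 0 < 1 - y 0 := by linarith [h0.2]
    have a1 : 0 < 1 - y 1 := by linarith [h1.2]
    have a2 : 0 < 1 - y 2 := by linarith [h2.2]
    have hL : 0 < 1 - (1 - y 1 * y 2) * y 0 := link_pos h1 h2 h0
    have c0 := h0.1; have c1 := h1.1; have c2 := h2.1
    positivity
  have hxx := mem_cube hx 0; have hyy := mem_cube hx 1
  have hlam : 0 < 1 - x 0 * x 1 := by nlinarith [mul_lt_of_lt_one_right hxx.1 hyy.2]
  have hlam1 : 1 - x 0 * x 1 < 1 := by nlinarith [mul_pos hxx.1 hyy.1]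
  set K : ℝ := x 0 ^ h * (1 - x 0) ^ l * x 1 ^ k * (1 - x 1) ^ s with hK
  have hF : (fun t : ℝ => Matrix.vecCons t x 1 ^ h * (1 - Matrix.vecCons t x 1) ^ l * Matrix.vecCons t x 2 ^ k *
        (1 - Matrix.vecCons t x 2) ^ s * Matrix.vecCons t x 0 ^ j * (1 - Matrix.vecCons t x 0) ^ q /
        (1 - (1 - Matrix.vecCons t x 1 * Matrix.vecCons t x 2) * Matrix.vecCons t x 0) ^ (m + 1)) =
      fun t => K * (t ^ j * (1 - t) ^ q / (1 + (-(1 - x 0 * x 1)) * t) ^ (m + 1)) := by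
    funext t
    simp only [Matrix.cons_val_zero, Matrix.cons_val_one, Matrix.cons_val, hK]
    rw [show (1:ℝ) - (1 - x 0 * x 1) * t = 1 + (-(1 - x 0 * x 1)) * t by ring]
    ring
  have hG : (fun t : ℝ => Matrix.vecCons t x 1 ^ h * (1 - Matrix.vecCons t x 1) ^ l * Matrix.vecCons t x 2 ^ k *
        (1 - Matrix.vecCons t x 2) ^ s * Matrix.vecCons t x 0 ^ m * (1 - Matrix.vecCons t x 0) ^ (j + q - m) /
        (1 - (1 - Matrix.vecCons t x 1 * Matrix.vecCons t x 2) * Matrix.vecCons t x 0) ^ (j + 1)) =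
      fun t => K * (t ^ m * (1 - t) ^ (j + q - m) / (1 + (-(1 - x 0 * x 1)) * t) ^ (j + 1)) := by
    funext t
    simp only [Matrix.cons_val_zero, Matrix.cons_val_one, Matrix.cons_val, hK]
    rw [show (1:ℝ) - (1 - x 0 * x 1) * t = 1 + (-(1 - x 0 * x 1)) * t by ring]
    ring
  refine ⟨?_, ?_, ?_⟩
  · rw [hF]; exact integrableOn_kernel' _ one_pos (by linarith) _ _ _
  · rw [hG]; exact integrableOn_kernel' _ one_pos (by linarith) _ _ _
  · rw [hF, hG, integral_const_mul, integral_const_mul, setIntegral_Ioo_eq_intervalIntegral,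
      setIntegral_Ioo_eq_intervalIntegral]
    have hE := RhinViola.euler_integral_symm_nat (p := j) (r := q) (p' := m) (r' := j + q - m) (by omega)
      (t := 1 - x 0 * x 1) hlam1
    have e1 : (fun t : ℝ => t ^ j * (1 - t) ^ q / (1 + (-(1 - x 0 * x 1)) * t) ^ (m + 1)) =
        fun t => t ^ j * (1 - t) ^ q / (1 - t * (1 - x 0 * x 1)) ^ (m + 1) := by
      funext t; congr 1; ring
    have e2 : (fun t : ℝ => t ^ m * (1 - t) ^ (j + q - m) / (1 + (-(1 - x 0 * x 1)) * t) ^ (j + 1)) =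
        fun t => t ^ m * (1 - t) ^ (j + q - m) / (1 - t * (1 - x 0 * x 1)) ^ (j + 1) := by
      funext t; congr 1; ring
    rw [e1, e2]
    generalize (∫ t in (0:ℝ)..1, t ^ j * (1 - t) ^ q / (1 - t * (1 - x 0 * x 1)) ^ (m + 1)) = I₁ at hE ⊢
    generalize (∫ t in (0:ℝ)..1, t ^ m * (1 - t) ^ (j + q - m) / (1 - t * (1 - x 0 * x 1)) ^ (j + 1)) = I₂ at hE ⊢
    push_cast
    linear_combination K * hE

end Summit.KontsevichZagierPeriods.Zeta5Search.RhinViolaGenerators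

end
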